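import Mathlib
import Summits.Ventures.HodgeRepro.Tier4.Target
import Summits.Ventures.HodgeRepro.Tier4.Common.AutForms
import Summits.Ventures.HodgeRepro.Tier4.Line3.DatumOrthVanishing
import Summits.Ventures.HodgeRepro.Tier4.Line3.HeckeEquivarianceLemmas
import Summits.Ventures.HodgeRepro.Tier4.Line3.SlotFunctionAlgebra
import Summits.Ventures.HodgeRepro.Tier4.Line3.ModelIntegrand

/-!
# Tier4/Line3/ShapeIntegrandBounds — pointwise bounds on the shape integrand: near the common zero and away from it

Blind re-derivation cell `pub-hodge-repro`, Tier 4 «PROVE THE STEP» (README §9–§10), LINE L3, seat t4-L3-p1 (gen 3),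
self-cut C-L3-DILCOMP (bus S14565), module 3 of 5.

* `f_j(z) = ℓ_j(z − z*)` (`jform_lift3_eq_slotLin_sub`); `‖f_j‖ ≤ B_j = ‖y_j 0‖ + ‖y_j 1‖ + ‖y_j 2‖` on the ball
  (`norm_jform_lift3_le`); the shape integrand is continuous on the ball (`continuousOn_shapeInt`);
* **near** (`g ≥ g₀ > 0`, `g ≤ 1`): `w₀ · modelInt (4πs/g₀) (z − z*) ≤ shapeInt (2s) (2s) z` when `‖W z‖² ≥ w₀`
  (`shapeInt_ge_near`) and `shapeInt (2s) (2s) z ≤ g₀⁻⁴ (C₁ + C₂/g₀)² · modelInt (4πs) (z − z*)` when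
  `‖W z‖ ≤ C₁ + C₂/g` (`shapeInt_le_near`);
* **far** (`‖z − z*‖ ≥ r` in the sup norm, so `‖f₀‖² + ‖f₁‖² ≥ σ² r²` by coercivity): with `t = 1/g ≥ 1`,
  `shapeInt α β z ≤ B₀² B₁² (C₁+C₂)² t⁶ e^{−2π σ² r² m t} ≤ B₀² B₁² (C₁+C₂)² · 720/(2π σ² r² m)⁶` for `m ≤ α, β`
  (`far_bound_aux`, `shapeInt_le_far`; `t⁶ e^{−κt} ≤ 720/κ⁶` from the sixth Taylor term of `exp`,
  `pow_six_mul_exp_neg_le`).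

Imports: Mathlib, `Tier4/Target`, `Line3/{DatumOrthVanishing, HeckeEquivarianceLemmas, SlotFunctionAlgebra,
ModelIntegrand}` by name.  `#print axioms` of every theorem = `[propext, Classical.choice, Quot.sound]`.  No printed
input is consumed.  Nothing here asserts anything about the truth of (P); HC_CM is NOT proved by anyone in this repository.
-/

set_option autoImplicit false

noncomputable section

namespace Summit.Ventures.HodgeRepro.Tier4.Line3

open Summit.Ventures.HodgeRepro.Tier4
open Matrix MeasureTheory
open scoped ComplexConjugate

/-! ## 6. Pointwise bounds on the shape integrand: near the common zero and away from it -/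

/-- The slot function is the linear part at `z − z*`. -/
theorem jform_lift3_eq_slotLin_sub (y₀ y₁ : Fin 3 → ℂ) (hab : y₀ 0 * y₁ 1 - y₀ 1 * y₁ 0 ≠ 0) (z : Fin 2 → ℂ) :
    star (lift3 z) ⬝ᵥ (J *ᵥ y₀) = slotLin y₀ (z - commonZero y₀ y₁) ∧
    star (lift3 z) ⬝ᵥ (J *ᵥ y₁) = slotLin y₁ (z - commonZero y₀ y₁) := by
  have h0 := jform_lift3_add (z - commonZero y₀ y₁) (commonZero y₀ y₁) y₀
  have h1 := jform_lift3_add (z - commonZero y₀ y₁) (commonZero y₀ y₁) y₁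
  rw [sub_add_cancel, jform_lift3_commonZero_left y₀ y₁ hab, add_zero] at h0
  rw [sub_add_cancel, jform_lift3_commonZero_right y₀ y₁ hab, add_zero] at h1
  exact ⟨h0, h1⟩

/-- `‖z k‖ ≤ 1` on the ball. -/
theorem norm_apply_le_one_of_mem_ball {z : Fin 2 → ℂ} (hz : z ∈ ball) (k : Fin 2) : ‖z k‖ ≤ 1 := by
  have h : nsq z < 1 := hz
  have h0 := sq_nonneg ‖z 0‖
  have h1 := sq_nonneg ‖z 1‖
  have hk : ‖z k‖ ^ 2 ≤ 1 := by
    fin_cases k <;> simp only [nsq] at h <;> simp <;> nlinarith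
  nlinarith [norm_nonneg (z k)]

/-- The slot function is bounded on the ball by `‖y₀‖ + ‖y₁‖ + ‖y₂‖`. -/
theorem norm_jform_lift3_le (y : Fin 3 → ℂ) {z : Fin 2 → ℂ} (hz : z ∈ ball) :
    ‖star (lift3 z) ⬝ᵥ (J *ᵥ y)‖ ≤ ‖y 0‖ + ‖y 1‖ + ‖y 2‖ := by
  rw [jform_lift3]
  have h0 := norm_apply_le_one_of_mem_ball hz 0
  have h1 := norm_apply_le_one_of_mem_ball hz 1
  calc ‖conj (z 0) * y 0 + conj (z 1) * y 1 - y 2‖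
      ≤ ‖conj (z 0) * y 0 + conj (z 1) * y 1‖ + ‖y 2‖ := norm_sub_le _ _
    _ ≤ ‖conj (z 0) * y 0‖ + ‖conj (z 1) * y 1‖ + ‖y 2‖ := by gcongr; exact norm_add_le _ _
    _ = ‖z 0‖ * ‖y 0‖ + ‖z 1‖ * ‖y 1‖ + ‖y 2‖ := by
        rw [norm_mul, norm_mul, Complex.norm_conj, Complex.norm_conj]
    _ ≤ 1 * ‖y 0‖ + 1 * ‖y 1‖ + ‖y 2‖ := by gcongr
    _ = ‖y 0‖ + ‖y 1‖ + ‖y 2‖ := by ring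

/-- Continuity of the slot function in `z`. -/
theorem continuous_jform_lift3 (y : Fin 3 → ℂ) : Continuous (fun z : Fin 2 → ℂ => star (lift3 z) ⬝ᵥ (J *ᵥ y)) := by
  have : (fun z : Fin 2 → ℂ => star (lift3 z) ⬝ᵥ (J *ᵥ y)) = fun z => slotLin y z - y 2 := by
    funext z; exact jform_lift3_eq_slotLin z y
  rw [this]
  exact (continuous_slotLin y).sub continuous_const

/-- The shape integrand is continuous on the ball. -/
theorem continuousOn_shapeInt (y₀ y₁ : Fin 3 → ℂ) (W : (Fin 2 → ℂ) → ℂ) (hWc : ContinuousOn W ball) (α β : ℝ) :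
    ContinuousOn (shapeInt y₀ y₁ W α β) ball := by
  have hg : ContinuousOn (fun z : Fin 2 → ℂ => 1 - nsq z) ball :=
    (continuous_const.sub continuous_nsq).continuousOn
  have hg0 : ∀ z ∈ ball, 1 - nsq z ≠ 0 := fun z hz => by
    have : nsq z < 1 := hz
    linarith
  have hf0 : ContinuousOn (fun z : Fin 2 → ℂ => ‖star (lift3 z) ⬝ᵥ (J *ᵥ y₀)‖ ^ 2) ball :=
    ((continuous_jform_lift3 y₀).norm.pow 2).continuousOn
  have hf1 : ContinuousOn (fun z : Fin 2 → ℂ => ‖star (lift3 z) ⬝ᵥ (J *ᵥ y₁)‖ ^ 2) ball :=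
    ((continuous_jform_lift3 y₁).norm.pow 2).continuousOn
  have hW2 : ContinuousOn (fun z => ‖W z‖ ^ 2) ball := hWc.norm.pow 2
  have hm0 : ContinuousOn (fun z : Fin 2 → ℂ => 2 * ‖star (lift3 z) ⬝ᵥ (J *ᵥ y₀)‖ ^ 2 / (1 - nsq z)) ball :=
    (continuousOn_const.mul hf0).div hg hg0
  have hm1 : ContinuousOn (fun z : Fin 2 → ℂ => 2 * ‖star (lift3 z) ⬝ᵥ (J *ᵥ y₁)‖ ^ 2 / (1 - nsq z)) ball :=
    (continuousOn_const.mul hf1).div hg hg0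
  have hexp : ContinuousOn (fun z : Fin 2 → ℂ => Real.exp (-(Real.pi *
      (α * (2 * ‖star (lift3 z) ⬝ᵥ (J *ᵥ y₀)‖ ^ 2 / (1 - nsq z)) +
        β * (2 * ‖star (lift3 z) ⬝ᵥ (J *ᵥ y₁)‖ ^ 2 / (1 - nsq z)))))) ball :=
    Real.continuous_exp.comp_continuousOn
      (continuousOn_const.mul ((continuousOn_const.mul hm0).add (continuousOn_const.mul hm1))).neg
  have hQ : ContinuousOn (fun z : Fin 2 → ℂ =>
      ‖star (lift3 z) ⬝ᵥ (J *ᵥ y₀)‖ ^ 2 * ‖star (lift3 z) ⬝ᵥ (J *ᵥ y₁)‖ ^ 2 / (1 - nsq z) ^ 4) ball :=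
    (hf0.mul hf1).div (hg.pow 4) fun z hz => pow_ne_zero 4 (hg0 z hz)
  exact (hQ.mul hW2).mul hexp

/-- **NEAR POINTWISE LOWER BOUND:** on a point with `g ≥ g₀ > 0`, `g ≤ 1`, and `‖W‖² ≥ w₀`, the shape integrand at
`(2s, 2s)` dominates `w₀ · modelInt (4π/g₀ · s) (z − z*)`. -/
theorem shapeInt_ge_near (y₀ y₁ : Fin 3 → ℂ) (hab : y₀ 0 * y₁ 1 - y₀ 1 * y₁ 0 ≠ 0) (W : (Fin 2 → ℂ) → ℂ)
    {g₀ w₀ s : ℝ} (hg₀ : 0 < g₀) (hs : 0 ≤ s) {z : Fin 2 → ℂ}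
    (hg : g₀ ≤ 1 - nsq z) (hW : w₀ ≤ ‖W z‖ ^ 2) :
    w₀ * modelInt y₀ y₁ (4 * Real.pi / g₀ * s) (z - commonZero y₀ y₁) ≤ shapeInt y₀ y₁ W (2 * s) (2 * s) z := by
  obtain ⟨e0, e1⟩ := jform_lift3_eq_slotLin_sub y₀ y₁ hab z
  unfold shapeInt modelInt
  rw [← e0, ← e1]
  set F0 := ‖star (lift3 z) ⬝ᵥ (J *ᵥ y₀)‖ ^ 2
  set F1 := ‖star (lift3 z) ⬝ᵥ (J *ᵥ y₁)‖ ^ 2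
  set g := 1 - nsq z
  have hgpos : 0 < g := lt_of_lt_of_le hg₀ hg
  have hg1 : g ≤ 1 := by have := zero_le_nsq z; simp only [g]; linarith
  have hF0 : 0 ≤ F0 := by positivity
  have hF1 : 0 ≤ F1 := by positivity
  -- the exponent comparison
  have hexp : Real.exp (-(4 * Real.pi / g₀ * s * (F0 + F1))) ≤
      Real.exp (-(Real.pi * (2 * s * (2 * F0 / g) + 2 * s * (2 * F1 / g)))) := by
    rw [Real.exp_le_exp]
    have h1 : (F0 + F1) / g ≤ (F0 + F1) / g₀ := div_le_div_of_nonneg_left (by positivity) hg₀ hg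
    have h2 : Real.pi * (2 * s * (2 * F0 / g) + 2 * s * (2 * F1 / g)) = 4 * Real.pi * s * ((F0 + F1) / g) := by
      field_simp
      ring
    have h3 : 4 * Real.pi / g₀ * s * (F0 + F1) = 4 * Real.pi * s * ((F0 + F1) / g₀) := by
      field_simp
    rw [h2, h3]
    have : 0 ≤ 4 * Real.pi * s := by positivity
    nlinarith [mul_le_mul_of_nonneg_left h1 this]
  -- `g^{-4} ≥ 1`
  have hg4 : 1 ≤ (g ^ 4)⁻¹ := by
    rw [one_le_inv₀ (by positivity)]
    exact pow_le_one₀ hgpos.le hg1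
  calc w₀ * (F0 * F1 * Real.exp (-(4 * Real.pi / g₀ * s * (F0 + F1))))
      ≤ ‖W z‖ ^ 2 * (F0 * F1 * Real.exp (-(Real.pi * (2 * s * (2 * F0 / g) + 2 * s * (2 * F1 / g))))) := by
        gcongr
    _ = F0 * F1 * 1 * ‖W z‖ ^ 2 * Real.exp (-(Real.pi * (2 * s * (2 * F0 / g) + 2 * s * (2 * F1 / g)))) := by
        ring
    _ ≤ F0 * F1 * (g ^ 4)⁻¹ * ‖W z‖ ^ 2 *
          Real.exp (-(Real.pi * (2 * s * (2 * F0 / g) + 2 * s * (2 * F1 / g)))) := by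
        gcongr
    _ = F0 * F1 / g ^ 4 * ‖W z‖ ^ 2 *
          Real.exp (-(Real.pi * (2 * s * (2 * F0 / g) + 2 * s * (2 * F1 / g)))) := by
        rw [div_eq_mul_inv (F0 * F1) (g ^ 4)]

/-- **NEAR POINTWISE UPPER BOUND:** on a point with `g ≥ g₀ > 0`, `‖W‖ ≤ C₁ + C₂/g` (`C₁, C₂ ≥ 0`), the shape
integrand at `(2s, 2s)` is at most `g₀^{-4} (C₁ + C₂/g₀)² · modelInt (4π s) (z − z*)`. -/
theorem shapeInt_le_near (y₀ y₁ : Fin 3 → ℂ) (hab : y₀ 0 * y₁ 1 - y₀ 1 * y₁ 0 ≠ 0) (W : (Fin 2 → ℂ) → ℂ)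
    {g₀ C₁ C₂ s : ℝ} (hg₀ : 0 < g₀) (hC₂ : 0 ≤ C₂) (hs : 0 ≤ s) {z : Fin 2 → ℂ}
    (hg : g₀ ≤ 1 - nsq z) (hW : ‖W z‖ ≤ C₁ + C₂ / (1 - nsq z)) :
    shapeInt y₀ y₁ W (2 * s) (2 * s) z ≤
      (g₀ ^ 4)⁻¹ * (C₁ + C₂ / g₀) ^ 2 * modelInt y₀ y₁ (4 * Real.pi * s) (z - commonZero y₀ y₁) := by
  obtain ⟨e0, e1⟩ := jform_lift3_eq_slotLin_sub y₀ y₁ hab z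
  unfold shapeInt modelInt
  rw [← e0, ← e1]
  set F0 := ‖star (lift3 z) ⬝ᵥ (J *ᵥ y₀)‖ ^ 2
  set F1 := ‖star (lift3 z) ⬝ᵥ (J *ᵥ y₁)‖ ^ 2
  set g := 1 - nsq z
  have hgpos : 0 < g := lt_of_lt_of_le hg₀ hg
  have hg1 : g ≤ 1 := by have := zero_le_nsq z; simp only [g]; linarith
  have hF0 : 0 ≤ F0 := by positivity
  have hF1 : 0 ≤ F1 := by positivity
  have hexp : Real.exp (-(Real.pi * (2 * s * (2 * F0 / g) + 2 * s * (2 * F1 / g)))) ≤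
      Real.exp (-(4 * Real.pi * s * (F0 + F1))) := by
    rw [Real.exp_le_exp]
    have h2 : Real.pi * (2 * s * (2 * F0 / g) + 2 * s * (2 * F1 / g)) = 4 * Real.pi * s * ((F0 + F1) / g) := by
      field_simp
      ring
    rw [h2]
    have h1 : F0 + F1 ≤ (F0 + F1) / g := by
      rw [le_div_iff₀ hgpos]
      nlinarith
    have : 0 ≤ 4 * Real.pi * s := by positivity
    nlinarith [mul_le_mul_of_nonneg_left h1 this]
  have hW2 : ‖W z‖ ^ 2 ≤ (C₁ + C₂ / g₀) ^ 2 := by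
    have : C₁ + C₂ / g ≤ C₁ + C₂ / g₀ := by
      gcongr
    exact pow_le_pow_left₀ (norm_nonneg _) (hW.trans this) 2
  have hg4 : (g ^ 4)⁻¹ ≤ (g₀ ^ 4)⁻¹ := by
    gcongr
  calc F0 * F1 / g ^ 4 * ‖W z‖ ^ 2 * Real.exp (-(Real.pi * (2 * s * (2 * F0 / g) + 2 * s * (2 * F1 / g))))
      = (g ^ 4)⁻¹ * ‖W z‖ ^ 2 * (F0 * F1 *
          Real.exp (-(Real.pi * (2 * s * (2 * F0 / g) + 2 * s * (2 * F1 / g))))) := by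
        rw [div_eq_mul_inv]; ring
    _ ≤ (g₀ ^ 4)⁻¹ * (C₁ + C₂ / g₀) ^ 2 * (F0 * F1 * Real.exp (-(4 * Real.pi * s * (F0 + F1)))) := by
        gcongr

/-- `t⁶ e^{−κ t} ≤ 720 / κ⁶` for `t ≥ 0`, `κ > 0`. -/
theorem pow_six_mul_exp_neg_le {κ t : ℝ} (hκ : 0 < κ) (ht : 0 ≤ t) :
    t ^ 6 * Real.exp (-(κ * t)) ≤ 720 / κ ^ 6 := by
  have h := Real.pow_div_factorial_le_exp (κ * t) (by positivity) 6
  have h6 : ((Nat.factorial 6 : ℕ) : ℝ) = 720 := by norm_num [Nat.factorial]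
  rw [h6] at h
  have hE : 0 < Real.exp (κ * t) := Real.exp_pos _
  rw [Real.exp_neg, ← div_eq_mul_inv, div_le_div_iff₀ hE (by positivity)]
  have : (κ * t) ^ 6 = κ ^ 6 * t ^ 6 := by ring
  rw [this] at h
  rw [div_le_iff₀ (by norm_num)] at h
  linarith

/-- The far bound on the real numbers: with `t = 1/g ≥ 1`, `F_j ≤ B_j`, `Wn ≤ C₁ + C₂/g`, `κ ≤ F₀ + F₁`,
`m ≤ α, β`: `F₀ F₁ g^{-4} Wn² e^{−π(α 2F₀/g + β 2F₁/g)} ≤ B₀ B₁ (C₁+C₂)² · 720/(2π κ m)⁶`. -/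
theorem far_bound_aux {F0 F1 g Wn B0 B1 C₁ C₂ κ α β m : ℝ} (hF0 : 0 ≤ F0) (hF1 : 0 ≤ F1) (hg : 0 < g)
    (hg1 : g ≤ 1) (hB0 : F0 ≤ B0) (hB1 : F1 ≤ B1) (hWn : 0 ≤ Wn) (hW : Wn ≤ C₁ + C₂ / g) (hC₁ : 0 ≤ C₁)
    (hκ : 0 < κ) (hE : κ ≤ F0 + F1) (hm : 0 < m) (hα : m ≤ α) (hβ : m ≤ β) :
    F0 * F1 / g ^ 4 * Wn ^ 2 * Real.exp (-(Real.pi * (α * (2 * F0 / g) + β * (2 * F1 / g)))) ≤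
      B0 * B1 * (C₁ + C₂) ^ 2 * (720 / (2 * Real.pi * κ * m) ^ 6) := by
  obtain ⟨t, ht⟩ : ∃ t : ℝ, t = g⁻¹ := ⟨_, rfl⟩
  have htpos : 0 < t := by rw [ht]; exact inv_pos.2 hg
  have ht1 : 1 ≤ t := by rw [ht]; exact (one_le_inv₀ hg).2 hg1
  have hdiv : ∀ x : ℝ, x / g = x * t := fun x => by rw [div_eq_mul_inv, ht]
  have hg4 : F0 * F1 / g ^ 4 = F0 * F1 * t ^ 4 := by rw [div_eq_mul_inv, ht, inv_pow]
  rw [hg4, hdiv, hdiv]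
  rw [hdiv] at hW
  have hWt : Wn ≤ (C₁ + C₂) * t := by nlinarith
  have hW2 : Wn ^ 2 ≤ (C₁ + C₂) ^ 2 * t ^ 2 := by
    rw [← mul_pow]; exact pow_le_pow_left₀ hWn hWt 2
  have hexp : Real.exp (-(Real.pi * (α * (2 * F0 * t) + β * (2 * F1 * t)))) ≤
      Real.exp (-(2 * Real.pi * κ * m * t)) := by
    rw [Real.exp_le_exp, neg_le_neg_iff]
    have h1 : 2 * Real.pi * κ * m * t ≤ 2 * Real.pi * m * (F0 + F1) * t := by
      have : 0 ≤ 2 * Real.pi * m * t := by positivity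
      nlinarith [mul_le_mul_of_nonneg_left hE this]
    have hα' : m * (2 * F0 * t) ≤ α * (2 * F0 * t) := mul_le_mul_of_nonneg_right hα (by positivity)
    have hβ' : m * (2 * F1 * t) ≤ β * (2 * F1 * t) := mul_le_mul_of_nonneg_right hβ (by positivity)
    nlinarith [Real.pi_pos]
  have hkey : t ^ 6 * Real.exp (-(2 * Real.pi * κ * m * t)) ≤ 720 / (2 * Real.pi * κ * m) ^ 6 :=
    pow_six_mul_exp_neg_le (by positivity) htpos.le
  have hB : F0 * F1 ≤ B0 * B1 := mul_le_mul hB0 hB1 hF1 (hF0.trans hB0)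
  have hB0' : 0 ≤ B0 := hF0.trans hB0
  have hB1' : 0 ≤ B1 := hF1.trans hB1
  calc F0 * F1 * t ^ 4 * Wn ^ 2 * Real.exp (-(Real.pi * (α * (2 * F0 * t) + β * (2 * F1 * t))))
      ≤ B0 * B1 * t ^ 4 * ((C₁ + C₂) ^ 2 * t ^ 2) * Real.exp (-(2 * Real.pi * κ * m * t)) := by
        refine mul_le_mul (mul_le_mul (mul_le_mul_of_nonneg_right hB (by positivity)) hW2 (sq_nonneg _) ?_)
          hexp (Real.exp_pos _).le ?_
        · exact mul_nonneg (mul_nonneg hB0' hB1') (by positivity)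
        · exact mul_nonneg (mul_nonneg (mul_nonneg hB0' hB1') (by positivity)) (by positivity)
    _ = B0 * B1 * (C₁ + C₂) ^ 2 * (t ^ 6 * Real.exp (-(2 * Real.pi * κ * m * t))) := by ring
    _ ≤ B0 * B1 * (C₁ + C₂) ^ 2 * (720 / (2 * Real.pi * κ * m) ^ 6) := by
        have : 0 ≤ B0 * B1 * (C₁ + C₂) ^ 2 := by
          have := hF0.trans hB0
          have := hF1.trans hB1
          positivity
        exact mul_le_mul_of_nonneg_left hkey this

/-- **FAR POINTWISE BOUND:** on a point of the ball with `‖z − z*‖ ≥ r` (sup norm), with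
`‖W‖ ≤ C₁ + C₂/g` (`C₁, C₂ ≥ 0`) and `m ≤ α`, `m ≤ β`, `m > 0`, the shape integrand is at most
`B₀² B₁² (C₁+C₂)² · 720 / (2π σ² r² m)⁶`, where `B_j = ‖y_j 0‖ + ‖y_j 1‖ + ‖y_j 2‖` and `σ² = ‖Δ‖²/(4N)`. -/
theorem shapeInt_le_far (y₀ y₁ : Fin 3 → ℂ) (hab : y₀ 0 * y₁ 1 - y₀ 1 * y₁ 0 ≠ 0) (W : (Fin 2 → ℂ) → ℂ)
    {C₁ C₂ : ℝ} (hC₁ : 0 ≤ C₁) {r m α β : ℝ} (hr : 0 < r) (hm : 0 < m) (hα : m ≤ α) (hβ : m ≤ β)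
    {z : Fin 2 → ℂ} (hz : z ∈ ball) (hzr : r ≤ ‖z - commonZero y₀ y₁‖) (hW : ‖W z‖ ≤ C₁ + C₂ / (1 - nsq z)) :
    shapeInt y₀ y₁ W α β z ≤
      (‖y₀ 0‖ + ‖y₀ 1‖ + ‖y₀ 2‖) ^ 2 * (‖y₁ 0‖ + ‖y₁ 1‖ + ‖y₁ 2‖) ^ 2 * (C₁ + C₂) ^ 2 *
        (720 / (2 * Real.pi * (‖y₀ 0 * y₁ 1 - y₀ 1 * y₁ 0‖ ^ 2 /
          (4 * (‖y₀ 0‖ ^ 2 + ‖y₀ 1‖ ^ 2 + ‖y₁ 0‖ ^ 2 + ‖y₁ 1‖ ^ 2)) * r ^ 2) * m) ^ 6) := by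
  obtain ⟨e0, e1⟩ := jform_lift3_eq_slotLin_sub y₀ y₁ hab z
  obtain ⟨σ2, hσ2⟩ : ∃ σ2 : ℝ, σ2 = ‖y₀ 0 * y₁ 1 - y₀ 1 * y₁ 0‖ ^ 2 /
      (4 * (‖y₀ 0‖ ^ 2 + ‖y₀ 1‖ ^ 2 + ‖y₁ 0‖ ^ 2 + ‖y₁ 1‖ ^ 2)) := ⟨_, rfl⟩
  rw [← hσ2]
  have hσ2pos : 0 < σ2 := by
    rw [hσ2]
    have := entries_sq_pos y₀ y₁ hab
    have := norm_pos_iff.2 hab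
    positivity
  -- the coordinates of `w = z − z*` are not both small
  have hwsq : r ^ 2 ≤ ‖(z - commonZero y₀ y₁) 0‖ ^ 2 + ‖(z - commonZero y₀ y₁) 1‖ ^ 2 := by
    by_contra hcon
    have hlt : ‖(z - commonZero y₀ y₁) 0‖ ^ 2 + ‖(z - commonZero y₀ y₁) 1‖ ^ 2 < r ^ 2 := lt_of_not_ge hcon
    have h0 : ‖(z - commonZero y₀ y₁) 0‖ < r := by
      nlinarith [sq_nonneg ‖(z - commonZero y₀ y₁) 1‖, norm_nonneg ((z - commonZero y₀ y₁) 0)]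
    have h1 : ‖(z - commonZero y₀ y₁) 1‖ < r := by
      nlinarith [sq_nonneg ‖(z - commonZero y₀ y₁) 0‖, norm_nonneg ((z - commonZero y₀ y₁) 1)]
    have : ‖z - commonZero y₀ y₁‖ < r := (pi_norm_lt_iff hr).2 fun i => by fin_cases i <;> assumption
    linarith
  -- coercivity: `σ² r² ≤ ‖f₀‖² + ‖f₁‖²`
  have hE : σ2 * r ^ 2 ≤ ‖star (lift3 z) ⬝ᵥ (J *ᵥ y₀)‖ ^ 2 + ‖star (lift3 z) ⬝ᵥ (J *ᵥ y₁)‖ ^ 2 := by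
    rw [e0, e1]
    calc σ2 * r ^ 2 ≤ σ2 * (‖(z - commonZero y₀ y₁) 0‖ ^ 2 + ‖(z - commonZero y₀ y₁) 1‖ ^ 2) := by gcongr
      _ ≤ _ := by rw [hσ2]; exact coercive_slotLin y₀ y₁ hab _
  have hgpos : 0 < 1 - nsq z := by have : nsq z < 1 := hz; linarith
  have hg1 : 1 - nsq z ≤ 1 := by have := zero_le_nsq z; linarith
  have hB0 : ‖star (lift3 z) ⬝ᵥ (J *ᵥ y₀)‖ ^ 2 ≤ (‖y₀ 0‖ + ‖y₀ 1‖ + ‖y₀ 2‖) ^ 2 :=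
    pow_le_pow_left₀ (norm_nonneg _) (norm_jform_lift3_le y₀ hz) 2
  have hB1 : ‖star (lift3 z) ⬝ᵥ (J *ᵥ y₁)‖ ^ 2 ≤ (‖y₁ 0‖ + ‖y₁ 1‖ + ‖y₁ 2‖) ^ 2 :=
    pow_le_pow_left₀ (norm_nonneg _) (norm_jform_lift3_le y₁ hz) 2
  unfold shapeInt
  exact far_bound_aux (by positivity) (by positivity) hgpos hg1 hB0 hB1 (norm_nonneg _) hW hC₁
    (by positivity) hE hm hα hβ



end Summit.Ventures.HodgeRepro.Tier4.Line3

end
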